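import Mathlib.Probability.Martingale.Centering
import Mathlib.Probability.Moments.SubGaussian
import Mathlib.Analysis.SpecialFunctions.Trigonometric.Series
import Mathlib.Analysis.Convex.SpecificFunctions.Basic
import HarnessLib

/-!
# Azuma–Hoeffding: exponential moments and tails of martingales with bounded differences

Topic `Literature/Probability/Moments`. Everything in this file is PROVED (no named facts, no new
definitions).

Setting: a filtration `ℱ` of an ARBITRARY measurable space `(Ω, m0)` indexed by `ℕ`, a probability
measure `μ`, and a real martingale `S` whose differences are almost surely bounded,
`|S_{i+1} - S_i| ≤ c_i` for all `i`. Then (Azuma 1967; Hoeffding 1963, Thm 2 with the remark closing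
his §2 that independence may be replaced by the martingale property)

* `integral_exp_mul_martingale_sub_le_exp_sum`: `𝔼 exp (t (S_n - S_0)) ≤ exp (t² Σ_{i<n} c_i² / 2)`,
  and `integral_exp_mul_martingale_sub_le`: the constant-bound case `≤ exp (n c² t² / 2)`;
* `hasSubgaussianMGF_martingale_sub`: i.e. `S_n - S_0` is sub-Gaussian with parameter `Σ_{i<n} c_i²`
  in the sense of Mathlib's `ProbabilityTheory.HasSubgaussianMGF`, so Mathlib's sub-Gaussian API
  applies; in particular the two Azuma tails `μ {ε ≤ S_n - S_0}, μ {S_n - S_0 ≤ -ε} ≤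
  exp (-ε² / (2 Σ_{i<n} c_i²))` (`measureReal_martingale_sub_ge_le`, `measureReal_martingale_sub_le_le`);
* `integral_exp_mul_martingalePart_sub_le`, `integral_exp_mul_martingalePart_le`,
  `lintegral_exp_mul_martingalePart_le`: the same for the martingale part `M = martingalePart f ℱ μ`
  of Doob's decomposition (Mathlib's `MeasureTheory.martingalePart`) of an ADAPTED process `f` with
  increments a.e. bounded by `R`: the martingale differences are then bounded by `2R`
  (`MeasureTheory.martingalePart_bdd_difference`), whence `𝔼 exp (t (M_n - f_0)) ≤ exp (2 n R² t²)`;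
  no integrability of `f` is assumed.

## Proof

Elementary and kernel-free (Mathlib's conditional sub-Gaussian machinery
`HasCondSubgaussianMGF` / `measure_sum_ge_le_of_hasCondSubgaussianMGF` goes through `condExpKernel` and
needs a standard Borel space; here the filtration is arbitrary). For `|x| ≤ a` convexity of `exp` gives
the chord bound `e^{sx} ≤ cosh (sa) + x sinh (sa) / a` (`exp_mul_le_cosh_add_mul_of_abs_le`); applied
to the increment `D = S_{n+1} - S_n` and integrated against the `ℱ_n`-measurable weight `e^{t(S_n - S_0)}`,
the linear term vanishes by the pull-out property and `μ[D | ℱ_n] = 0`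
(`integral_exp_add_mul_le_cosh_mul`), so `𝔼 e^{t(S_{n+1}-S_0)} ≤ cosh (t c_n) 𝔼 e^{t(S_n-S_0)}`, and
`cosh y ≤ e^{y²/2}` (`Real.cosh_le_exp_half_sq`) closes the induction.

## Not here

Hoeffding's sharper constant for one-sided ranges (`A_i ≤ S_{i+1} - S_i ≤ A_i + c_i` with predictable
`A_i`: `exp (t² Σ c_i² / 8)`), predictable (random) bounds `c_i`, and the maximal (Doob) form of the
tail bound.

## References
* W. Hoeffding, *Probability inequalities for sums of bounded random variables*, JASA 58 (1963),
  Thm 2 and end of §2; §4 for the convexity argument. [Hoeffding1963]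
* K. Azuma, *Weighted sums of certain dependent random variables*, Tôhoku Math. J. 19 (1967) 357–367.
-/

noncomputable section

namespace Literature.Probability.Moments

open _root_.MeasureTheory _root_.ProbabilityTheory _root_.Real Finset Filter
open scoped ENNReal NNReal

/-! ### Hoeffding's convexity step: `e^{sx} ≤ cosh(sa) + x·sinh(sa)/a` on `[-a, a]` -/

/-- **Chord bound for the exponential on a symmetric interval.** For `|x| ≤ a` and every real `s`,
`exp (s x) ≤ cosh (s a) + (sinh (s a) / a) · x`: the graph of the convex function `y ↦ e^{sy}` on
`[-a, a]` lies below its chord (for `a = 0` both sides equal `1`, with Lean's `0 / 0 = 0`).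
This is the first line of Hoeffding's proof of his Lemma/Theorem 2, for a symmetric range.
[cite: Hoeffding1963, §4 (convexity bound opening the proof of Thm 2)] -/
theorem exp_mul_le_cosh_add_mul_of_abs_le {a x : ℝ} (hx : |x| ≤ a) (s : ℝ) :
    Real.exp (s * x) ≤ Real.cosh (s * a) + Real.sinh (s * a) / a * x := by
  have ha : 0 ≤ a := (abs_nonneg x).trans hx
  rcases ha.eq_or_lt with rfl | ha
  · have hx0 : x = 0 := abs_nonpos_iff.mp hx
    simp [hx0]
  · have hx' := abs_le.mp hx
    have h2a : (0 : ℝ) < 2 * a := by positivity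
    set p := (a + x) / (2 * a) with hp
    set q := (a - x) / (2 * a) with hq
    have hp0 : 0 ≤ p := div_nonneg (by linarith [hx'.1]) h2a.le
    have hq0 : 0 ≤ q := div_nonneg (by linarith [hx'.2]) h2a.le
    have hpq : p + q = 1 := by
      rw [hp, hq, ← add_div]
      field_simp
      ring
    have key := convexOn_exp.2 (Set.mem_univ (s * a)) (Set.mem_univ (-(s * a))) hp0 hq0 hpq
    have hlhs : p • (s * a) + q • (-(s * a)) = s * x := by
      simp only [smul_eq_mul, hp, hq]
      field_simp
      ring
    rw [hlhs] at key
    refine key.trans (le_of_eq ?_)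
    simp only [smul_eq_mul, Real.cosh_eq, Real.sinh_eq, hp, hq]
    field_simp
    ring

/-! ### One conditional step -/

/-- **One Azuma step.** Let `m ≤ m0` be a sub-σ-algebra of a finite measure space, `X` an
`m`-measurable real function with `e^X` integrable, and `D` an integrable increment with `|D| ≤ c`
a.e. and `μ[D | m] = 0` a.e. Then `∫ exp (X + s D) dμ ≤ cosh (s c) · ∫ exp X dμ` for every real `s`:
by the chord bound `e^{sD} ≤ cosh (sc) + D sinh (sc) / c`, and `∫ e^X D = ∫ e^X μ[D | m] = 0` by the
pull-out property of the conditional expectation. [folklore] -/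
theorem integral_exp_add_mul_le_cosh_mul {Ω : Type*} {m m0 : MeasurableSpace Ω} {μ : Measure Ω}
    [IsFiniteMeasure μ] (hm : m ≤ m0) {X D : Ω → ℝ} {c : ℝ} (hX : StronglyMeasurable[m] X)
    (hXint : Integrable (fun ω => Real.exp (X ω)) μ) (hD : Integrable D μ)
    (hDbdd : ∀ᵐ ω ∂μ, |D ω| ≤ c) (hD0 : μ[D | m] =ᵐ[μ] 0) (s : ℝ) :
    ∫ ω, Real.exp (X ω + s * D ω) ∂μ ≤ Real.cosh (s * c) * ∫ ω, Real.exp (X ω) ∂μ := by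
  -- the product `e^X · D` is integrable with vanishing integral
  have hED : Integrable (fun ω => Real.exp (X ω) * D ω) μ :=
    hXint.mul_bdd hD.aestronglyMeasurable
      (hDbdd.mono fun ω hω => by simpa only [Real.norm_eq_abs] using hω)
  have hED0 : ∫ ω, Real.exp (X ω) * D ω ∂μ = 0 := by
    have hpull : μ[(fun ω => Real.exp (X ω)) * D | m] =ᵐ[μ]
        (fun ω => Real.exp (X ω)) * μ[D | m] :=
      condExp_mul_of_stronglyMeasurable_left (continuous_exp.comp_stronglyMeasurable hX) hED hD
    calc ∫ ω, Real.exp (X ω) * D ω ∂μ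
        = ∫ ω, (μ[(fun ω => Real.exp (X ω)) * D | m]) ω ∂μ := (integral_condExp hm).symm
      _ = ∫ ω, Real.exp (X ω) * (μ[D | m]) ω ∂μ := by
          refine integral_congr_ae ?_
          filter_upwards [hpull] with ω hω
          simpa only [Pi.mul_apply] using hω
      _ = 0 := by
          rw [← integral_zero Ω ℝ]
          refine integral_congr_ae ?_
          filter_upwards [hD0] with ω hω
          simp [hω]
  -- the pointwise chord bound, multiplied by the positive weight `e^X`
  have hpt : ∀ᵐ ω ∂μ, Real.exp (X ω + s * D ω) ≤
      Real.cosh (s * c) * Real.exp (X ω) + Real.sinh (s * c) / c * (Real.exp (X ω) * D ω) := by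
    filter_upwards [hDbdd] with ω hω
    rw [Real.exp_add]
    calc Real.exp (X ω) * Real.exp (s * D ω)
        ≤ Real.exp (X ω) * (Real.cosh (s * c) + Real.sinh (s * c) / c * D ω) :=
          mul_le_mul_of_nonneg_left (exp_mul_le_cosh_add_mul_of_abs_le hω s) (Real.exp_pos _).le
      _ = _ := by ring
  have hrhs : Integrable (fun ω => Real.cosh (s * c) * Real.exp (X ω) +
      Real.sinh (s * c) / c * (Real.exp (X ω) * D ω)) μ :=
    (hXint.const_mul _).add (hED.const_mul _)
  calc ∫ ω, Real.exp (X ω + s * D ω) ∂μ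
      ≤ ∫ ω, (Real.cosh (s * c) * Real.exp (X ω) +
          Real.sinh (s * c) / c * (Real.exp (X ω) * D ω)) ∂μ :=
        integral_mono_of_nonneg (ae_of_all _ fun ω => (Real.exp_pos _).le) hrhs hpt
    _ = Real.cosh (s * c) * ∫ ω, Real.exp (X ω) ∂μ +
          Real.sinh (s * c) / c * ∫ ω, Real.exp (X ω) * D ω ∂μ := by
        rw [integral_add (hXint.const_mul _) (hED.const_mul _), integral_const_mul,
          integral_const_mul]
    _ = Real.cosh (s * c) * ∫ ω, Real.exp (X ω) ∂μ := by rw [hED0, mul_zero, add_zero]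

/-! ### Azuma–Hoeffding for martingales with bounded differences -/

section Martingale

variable {Ω : Type*} {m0 : MeasurableSpace Ω} {μ : Measure Ω} {ℱ : Filtration ℕ m0}
  {S : ℕ → Ω → ℝ}

/-- Bounded differences `|S_{i+1} - S_i| ≤ c_i` (a.e., all `i`) give `|S_n - S_0| ≤ Σ_{i<n} c_i`
(a.e., all `n`). [folklore] -/
theorem ae_abs_sub_zero_le_of_bdd_difference {c : ℕ → ℝ}
    (hbdd : ∀ᵐ ω ∂μ, ∀ i, |S (i + 1) ω - S i ω| ≤ c i) :
    ∀ᵐ ω ∂μ, ∀ n, |S n ω - S 0 ω| ≤ ∑ i ∈ Finset.range n, c i := by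
  filter_upwards [hbdd] with ω hω
  intro n
  induction n with
  | zero => simp
  | succ n ih =>
    calc |S (n + 1) ω - S 0 ω| = |(S (n + 1) ω - S n ω) + (S n ω - S 0 ω)| := by ring_nf
      _ ≤ |S (n + 1) ω - S n ω| + |S n ω - S 0 ω| := abs_add_le _ _
      _ ≤ c n + ∑ i ∈ Finset.range n, c i := add_le_add (hω n) ih
      _ = ∑ i ∈ Finset.range (n + 1), c i := by rw [Finset.sum_range_succ, add_comm]

/-- Exponential moments of `t (S_n - S_0)` exist for an adapted process with bounded differences on a
finite measure space (the integrand is a.e. bounded by `exp (|t| Σ_{i<n} c_i)`). [folklore] -/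
theorem integrable_exp_mul_sub_of_bdd_difference [IsFiniteMeasure μ] (hS : StronglyAdapted ℱ S)
    {c : ℕ → ℝ} (hbdd : ∀ᵐ ω ∂μ, ∀ i, |S (i + 1) ω - S i ω| ≤ c i) (n : ℕ) (t : ℝ) :
    Integrable (fun ω => Real.exp (t * (S n ω - S 0 ω))) μ := by
  have hmeas : StronglyMeasurable (fun ω => Real.exp (t * (S n ω - S 0 ω))) :=
    continuous_exp.comp_stronglyMeasurable
      ((((hS n).mono (ℱ.le n)).sub ((hS 0).mono (ℱ.le 0))).const_mul t)
  refine Integrable.of_bound hmeas.aestronglyMeasurable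
    (Real.exp (|t| * ∑ i ∈ Finset.range n, c i)) ?_
  filter_upwards [ae_abs_sub_zero_le_of_bdd_difference hbdd] with ω hω
  rw [Real.norm_eq_abs, Real.abs_exp]
  refine Real.exp_le_exp.mpr ?_
  calc t * (S n ω - S 0 ω) ≤ |t * (S n ω - S 0 ω)| := le_abs_self _
    _ = |t| * |S n ω - S 0 ω| := abs_mul _ _
    _ ≤ |t| * ∑ i ∈ Finset.range n, c i := mul_le_mul_of_nonneg_left (hω n) (abs_nonneg t)

/-- **Azuma–Hoeffding inequality, exponential-moment form.** If `S` is a martingale (filtration `ℱ`,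
probability measure `μ`) whose differences are a.e. bounded, `|S_{i+1} - S_i| ≤ c_i` for all `i`,
then for every `n` and every real `t`, `𝔼 exp (t (S_n - S_0)) ≤ exp (t² Σ_{i<n} c_i² / 2)`.
Proof: peel off the last increment with `integral_exp_add_mul_le_cosh_mul`
(`μ[S_{n+1} - S_n | ℱ_n] = 0`) and use `cosh y ≤ exp (y² / 2)`. Hoeffding states his Theorem 2 for
independent bounded summands and notes at the end of his §2 that the martingale property suffices;
Azuma (1967) is the other classical reference.
[cite: Hoeffding1963, Thm 2 with the martingale remark closing §2] -/
theorem integral_exp_mul_martingale_sub_le_exp_sum [IsProbabilityMeasure μ] (hS : Martingale S ℱ μ)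
    {c : ℕ → ℝ} (hbdd : ∀ᵐ ω ∂μ, ∀ i, |S (i + 1) ω - S i ω| ≤ c i) (n : ℕ) (t : ℝ) :
    ∫ ω, Real.exp (t * (S n ω - S 0 ω)) ∂μ ≤
      Real.exp ((∑ i ∈ Finset.range n, c i ^ 2) * t ^ 2 / 2) := by
  induction n with
  | zero => simp
  | succ n ih =>
    -- peel off the last increment `D`, keeping the `ℱ n`-measurable exponent `X`
    set X : Ω → ℝ := fun ω => t * (S n ω - S 0 ω) with hXdef
    set D : Ω → ℝ := S (n + 1) - S n with hDdef
    have hX : StronglyMeasurable[ℱ n] X :=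
      ((hS.stronglyMeasurable n).sub
        ((hS.stronglyMeasurable 0).mono (ℱ.mono (Nat.zero_le n)))).const_mul t
    have hXint : Integrable (fun ω => Real.exp (X ω)) μ :=
      integrable_exp_mul_sub_of_bdd_difference hS.stronglyAdapted hbdd n t
    have hD : Integrable D μ := (hS.integrable (n + 1)).sub (hS.integrable n)
    have hDbdd : ∀ᵐ ω ∂μ, |D ω| ≤ c n := by
      filter_upwards [hbdd] with ω hω using hω n
    have hD0 : μ[D | ℱ n] =ᵐ[μ] 0 := by
      have h1 := condExp_sub (hS.integrable (n + 1)) (hS.integrable n) (ℱ n)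
      have h2 : μ[S (n + 1) | ℱ n] =ᵐ[μ] S n := hS.condExp_ae_eq n.le_succ
      have h3 : μ[S n | ℱ n] = S n :=
        condExp_of_stronglyMeasurable (ℱ.le n) (hS.stronglyMeasurable n) (hS.integrable n)
      filter_upwards [h1, h2] with ω hω1 hω2
      rw [hDdef, hω1, Pi.sub_apply, hω2, h3, sub_self, Pi.zero_apply]
    have hstep := integral_exp_add_mul_le_cosh_mul (ℱ.le n) hX hXint hD hDbdd hD0 t
    have hrw : (fun ω => Real.exp (t * (S (n + 1) ω - S 0 ω))) =
        fun ω => Real.exp (X ω + t * D ω) := by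
      funext ω
      simp only [hXdef, hDdef, Pi.sub_apply]
      ring_nf
    rw [hrw]
    refine hstep.trans ?_
    have hI : 0 ≤ ∫ ω, Real.exp (X ω) ∂μ := integral_nonneg fun ω => (Real.exp_pos _).le
    calc Real.cosh (t * c n) * ∫ ω, Real.exp (X ω) ∂μ
        ≤ Real.exp ((t * c n) ^ 2 / 2) *
            Real.exp ((∑ i ∈ Finset.range n, c i ^ 2) * t ^ 2 / 2) :=
          mul_le_mul (Real.cosh_le_exp_half_sq _) ih hI (Real.exp_pos _).le
      _ = Real.exp ((∑ i ∈ Finset.range (n + 1), c i ^ 2) * t ^ 2 / 2) := by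
          rw [← Real.exp_add, Finset.sum_range_succ]
          ring_nf

/-- **Azuma–Hoeffding inequality, exponential-moment form, constant bound**: differences a.e. bounded
by `c` give `𝔼 exp (t (S_n - S_0)) ≤ exp (n c² t² / 2)`.
[cite: Hoeffding1963, Thm 2 with the martingale remark closing §2] -/
theorem integral_exp_mul_martingale_sub_le [IsProbabilityMeasure μ] (hS : Martingale S ℱ μ)
    {c : ℝ} (hbdd : ∀ᵐ ω ∂μ, ∀ i, |S (i + 1) ω - S i ω| ≤ c) (n : ℕ) (t : ℝ) :
    ∫ ω, Real.exp (t * (S n ω - S 0 ω)) ∂μ ≤ Real.exp (n * c ^ 2 * t ^ 2 / 2) := by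
  have h := integral_exp_mul_martingale_sub_le_exp_sum hS (c := fun _ => c) hbdd n t
  simpa only [Finset.sum_const, Finset.card_range, nsmul_eq_mul] using h

/-- **Martingales with bounded differences are sub-Gaussian**: `S_n - S_0` has a sub-Gaussian moment
generating function with parameter `Σ_{i<n} c_i²` (Mathlib's `HasSubgaussianMGF`), so Mathlib's
sub-Gaussian API (Chernoff tails, sums, …) applies. [folklore] -/
theorem hasSubgaussianMGF_martingale_sub [IsProbabilityMeasure μ] (hS : Martingale S ℱ μ)
    {c : ℕ → ℝ≥0} (hbdd : ∀ᵐ ω ∂μ, ∀ i, |S (i + 1) ω - S i ω| ≤ c i) (n : ℕ) :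
    HasSubgaussianMGF (fun ω => S n ω - S 0 ω) (∑ i ∈ Finset.range n, c i ^ 2) μ where
  integrable_exp_mul t := integrable_exp_mul_sub_of_bdd_difference hS.stronglyAdapted hbdd n t
  mgf_le t := by
    have h := integral_exp_mul_martingale_sub_le_exp_sum hS hbdd n t
    simp only [mgf]
    convert h using 2
    push_cast
    ring

/-- **Azuma's inequality, upper tail**: for a martingale with differences a.e. bounded by `c_i` and
`ε ≥ 0`, `μ {ε ≤ S_n - S_0} ≤ exp (-ε² / (2 Σ_{i<n} c_i²))` (Chernoff bound from
`hasSubgaussianMGF_martingale_sub`; if `Σ c_i² = 0` the right-hand side is `exp 0 = 1` by `x / 0 = 0`).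
[cite: Hoeffding1963, Thm 2 with the martingale remark closing §2] -/
theorem measureReal_martingale_sub_ge_le [IsProbabilityMeasure μ] (hS : Martingale S ℱ μ)
    {c : ℕ → ℝ≥0} (hbdd : ∀ᵐ ω ∂μ, ∀ i, |S (i + 1) ω - S i ω| ≤ c i) (n : ℕ) {ε : ℝ}
    (hε : 0 ≤ ε) :
    μ.real {ω | ε ≤ S n ω - S 0 ω} ≤
      Real.exp (-ε ^ 2 / (2 * ∑ i ∈ Finset.range n, (c i : ℝ) ^ 2)) := by
  have h := (hasSubgaussianMGF_martingale_sub hS hbdd n).measure_ge_le hε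
  convert h using 3
  push_cast
  ring

/-- **Azuma's inequality, lower tail**: `μ {S_n - S_0 ≤ -ε} ≤ exp (-ε² / (2 Σ_{i<n} c_i²))` for
`ε ≥ 0` (the upper tail applied to the martingale `-S`). [folklore] -/
theorem measureReal_martingale_sub_le_le [IsProbabilityMeasure μ] (hS : Martingale S ℱ μ)
    {c : ℕ → ℝ≥0} (hbdd : ∀ᵐ ω ∂μ, ∀ i, |S (i + 1) ω - S i ω| ≤ c i) (n : ℕ) {ε : ℝ}
    (hε : 0 ≤ ε) :
    μ.real {ω | S n ω - S 0 ω ≤ -ε} ≤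
      Real.exp (-ε ^ 2 / (2 * ∑ i ∈ Finset.range n, (c i : ℝ) ^ 2)) := by
  have hbdd' : ∀ᵐ ω ∂μ, ∀ i, |(-S) (i + 1) ω - (-S) i ω| ≤ c i := by
    filter_upwards [hbdd] with ω hω i
    have e : (-S) (i + 1) ω - (-S) i ω = -(S (i + 1) ω - S i ω) := by
      simp only [Pi.neg_apply]
      ring
    rw [e, abs_neg]
    exact hω i
  have hset : {ω | S n ω - S 0 ω ≤ -ε} = {ω | ε ≤ (-S) n ω - (-S) 0 ω} := by
    ext ω
    simp only [Set.mem_setOf_eq, Pi.neg_apply, neg_sub_neg]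
    constructor <;> intro h <;> linarith
  rw [hset]
  exact measureReal_martingale_sub_ge_le hS.neg hbdd' n hε

end Martingale

/-! ### The martingale part of an adapted process with bounded increments -/

section MartingalePart

variable {Ω : Type*} {m0 : MeasurableSpace Ω}

/-- Shifting a process by its initial value shifts its martingale part by the same amount:
`martingalePart (f - f 0) = martingalePart f - f 0` (pointwise; the increments, hence the
compensators, coincide). [folklore] -/
theorem martingalePart_sub_initial (μ : Measure Ω) (ℱ : Filtration ℕ m0) (f : ℕ → Ω → ℝ) (n : ℕ) :
    martingalePart (fun k ω => f k ω - f 0 ω) ℱ μ n =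
      fun ω => martingalePart f ℱ μ n ω - f 0 ω := by
  have hg : ∀ i, ((fun k ω => f k ω - f 0 ω) (i + 1) - (fun k ω => f k ω - f 0 ω) i) =
      f (i + 1) - f i := by
    intro i
    funext ω
    simp only [Pi.sub_apply]
    ring
  rw [martingalePart_eq_sum, martingalePart_eq_sum]
  funext ω
  simp only [hg, Pi.add_apply, Finset.sum_apply, Pi.sub_apply, sub_self, zero_add]
  ring

/-- Real-valued form of Mathlib's `martingalePart_bdd_difference`: increments a.e. bounded by `R`
give martingale differences a.e. bounded by `2R`. [folklore] -/
theorem martingalePart_bdd_difference_abs (μ : Measure Ω) (ℱ : Filtration ℕ m0) {f : ℕ → Ω → ℝ}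
    {R : ℝ} (hbdd : ∀ᵐ ω ∂μ, ∀ i, |f (i + 1) ω - f i ω| ≤ R) :
    ∀ᵐ ω ∂μ, ∀ i, |martingalePart f ℱ μ (i + 1) ω - martingalePart f ℱ μ i ω| ≤ 2 * R := by
  have hbdd' : ∀ᵐ ω ∂μ, ∀ i, ‖f (i + 1) ω - f i ω‖ ≤ R :=
    hbdd.mono fun ω hω i => by rw [Real.norm_eq_abs]; exact hω i
  refine (martingalePart_bdd_difference (μ := μ) ℱ hbdd').mono fun ω hω i => ?_
  rw [← Real.norm_eq_abs]
  exact hω i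

/-- **Azuma–Hoeffding for Doob's martingale part, exponential-moment form.** Let `f` be a real
process adapted to a filtration `ℱ` on a probability space, with increments a.e. bounded:
`|f_{i+1} - f_i| ≤ R` for all `i`. Then the martingale part `M = martingalePart f ℱ μ` of its Doob
decomposition satisfies `𝔼 exp (t (M_n - f_0)) ≤ exp (2 n R² t²)` for all `n` and real `t`
(`M_0 = f_0`; the martingale differences `f_{i+1} - f_i - μ[f_{i+1} - f_i | ℱ_i]` are bounded by
`2R`, and `n (2R)² t² / 2 = 2 n R² t²`). No integrability of `f_0` is needed (pass to `f - f_0`).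
[folklore] -/
theorem integral_exp_mul_martingalePart_sub_le (μ : Measure Ω) [IsProbabilityMeasure μ]
    (ℱ : Filtration ℕ m0) (f : ℕ → Ω → ℝ) (R : ℝ) (hf : StronglyAdapted ℱ f)
    (hbdd : ∀ᵐ ω ∂μ, ∀ i, |f (i + 1) ω - f i ω| ≤ R) (n : ℕ) (t : ℝ) :
    ∫ ω, Real.exp (t * (martingalePart f ℱ μ n ω - f 0 ω)) ∂μ ≤
      Real.exp (2 * n * R ^ 2 * t ^ 2) := by
  -- pass to `g = f - f 0`, which starts at `0`
  set g : ℕ → Ω → ℝ := fun k ω => f k ω - f 0 ω with hgdef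
  have hg : StronglyAdapted ℱ g := fun k =>
    (hf k).sub ((hf 0).mono (ℱ.mono (Nat.zero_le k)))
  have hgbdd : ∀ᵐ ω ∂μ, ∀ i, |g (i + 1) ω - g i ω| ≤ R := by
    filter_upwards [hbdd] with ω hω i
    simpa only [hgdef, sub_sub_sub_cancel_right] using hω i
  have hg0 : ∀ ω, g 0 ω = 0 := fun ω => sub_self _
  -- `g k` is a.e. bounded by `k R`, hence integrable, so `martingalePart g` is a martingale
  have hgint : ∀ k, Integrable (g k) μ := by
    intro k
    refine Integrable.of_bound ((hg k).mono (ℱ.le k)).aestronglyMeasurable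
      (∑ i ∈ Finset.range k, R) ?_
    filter_upwards [ae_abs_sub_zero_le_of_bdd_difference (c := fun _ => R) hgbdd] with ω hω
    simpa only [Real.norm_eq_abs, hg0, sub_zero] using hω k
  have hS : Martingale (martingalePart g ℱ μ) ℱ μ := martingale_martingalePart hg hgint
  have h := integral_exp_mul_martingale_sub_le hS (martingalePart_bdd_difference_abs μ ℱ hgbdd) n t
  have hrw : (fun ω => Real.exp (t * (martingalePart f ℱ μ n ω - f 0 ω))) =
      fun ω => Real.exp (t * (martingalePart g ℱ μ n ω - martingalePart g ℱ μ 0 ω)) := by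
    funext ω
    rw [martingalePart_zero, hg0, sub_zero, hgdef, martingalePart_sub_initial]
  rw [hrw]
  refine h.trans (le_of_eq ?_)
  congr 1
  ring

/-- **Azuma–Hoeffding for Doob's martingale part of a process started at `0`.** With `f_0 = 0`,
`𝔼 exp (t · martingalePart f ℱ μ n) ≤ exp (2 n R² t²)`. [folklore] -/
theorem integral_exp_mul_martingalePart_le (μ : Measure Ω) [IsProbabilityMeasure μ]
    (ℱ : Filtration ℕ m0) (f : ℕ → Ω → ℝ) (R : ℝ) (hf : StronglyAdapted ℱ f)
    (h0 : ∀ ω, f 0 ω = 0) (hbdd : ∀ᵐ ω ∂μ, ∀ i, |f (i + 1) ω - f i ω| ≤ R) (n : ℕ) (t : ℝ) :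
    ∫ ω, Real.exp (t * martingalePart f ℱ μ n ω) ∂μ ≤ Real.exp (2 * n * R ^ 2 * t ^ 2) := by
  have h := integral_exp_mul_martingalePart_sub_le μ ℱ f R hf hbdd n t
  simpa only [h0, sub_zero] using h

/-- **Azuma–Hoeffding for Doob's martingale part, `lintegral` form** (the shape consumed by
pressure / free-energy estimates): with `f_0 = 0` and increments a.e. bounded by `R`,
`∫⁻ ofReal (exp (t · martingalePart f ℱ μ n)) dμ ≤ ofReal (exp (2 n R² t²))`. [folklore] -/
theorem lintegral_exp_mul_martingalePart_le (μ : Measure Ω) [IsProbabilityMeasure μ]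
    (ℱ : Filtration ℕ m0) (f : ℕ → Ω → ℝ) (R : ℝ) (hf : StronglyAdapted ℱ f)
    (h0 : ∀ ω, f 0 ω = 0) (hbdd : ∀ᵐ ω ∂μ, ∀ i, |f (i + 1) ω - f i ω| ≤ R) (n : ℕ) (t : ℝ) :
    ∫⁻ ω, ENNReal.ofReal (Real.exp (t * martingalePart f ℱ μ n ω)) ∂μ ≤
      ENNReal.ofReal (Real.exp (2 * n * R ^ 2 * t ^ 2)) := by
  have hint : Integrable (fun ω => Real.exp (t * martingalePart f ℱ μ n ω)) μ := by
    have h := integrable_exp_mul_sub_of_bdd_difference (μ := μ) (c := fun _ => 2 * R)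
      (stronglyAdapted_martingalePart (μ := μ) hf) (martingalePart_bdd_difference_abs μ ℱ hbdd) n t
    simpa only [martingalePart_zero, h0, sub_zero] using h
  rw [← ofReal_integral_eq_lintegral_ofReal hint (ae_of_all _ fun ω => (Real.exp_pos _).le)]
  exact ENNReal.ofReal_le_ofReal (integral_exp_mul_martingalePart_le μ ℱ f R hf h0 hbdd n t)

end MartingalePart

end Literature.Probability.Moments
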